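import Literature.MathematicalPhysics.QuantumFieldTheory.Balaban1983to89.B9SectBStepsKSCU
import Literature.MathematicalPhysics.QuantumFieldTheory.Balaban1983to89.B9SectBL2StepRecordOn
import Literature.MathematicalPhysics.QuantumFieldTheory.Balaban1983to89.B9SectBL2TransferConvY

/-!
# `Balaban1983to89.B9SectBStepsKSCUBlocks` — the Sect.-B block-steps of the U-LETTER coded readings `(KSCU, KACU, C⁻¹)`, II: the (3.42), (3.47) and
# (3.46) steps `StepEPos` ∕ `StepGlobPos` ∕ `StepL2Pos` of `KSCU` over the coded carrier (pub-ymgap N06 row 13 under node00-def-Y's ruling R13-U1)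

T. Bałaban, *Propagators for lattice gauge theories in a background field*, Commun. Math. Phys. **99** (1985) 389–434
[`Balaban1985BackgroundPropagators`, "B9"]; [4] = T. Bałaban, *Propagators and renormalization transformations for lattice gauge
theories. II*, Commun. Math. Phys. **96** (1984) 223–250 [`Balaban1984PropagatorsII`].

statement-level skeleton of published theorems with citation tags; proofs where landed; nothing here is a claim about the
Yang–Mills mass gap

THE PRINTED LOCI.  Theorem 3.1 (3.42), (3.46), (3.47) pp. 397–398 and the first remark after it («we may always replace ∇_U by ∇*_U»); Theorem 3.4
p. 400; Sect. B pp. 400–407, in particular p. 403 l.1–9 («all the statements (3.42)–(3.47) for G′(U′U)», the letters staying those of `U`).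

WHY THIS FILE (seat dag-n06-c gen 11).  The row-13 target of record `B9SectBCodedReadingsU.SectBStepU` is knit from positive-input block-steps of the
U-letter readings `KSCU` (G′) with the shared families `KACU` (G) and `pullS 𝔠 C⁻¹`.  The root Sect.-B frame over the coded carrier writes the AUGMENTED
coded family `KSC` (g7), whose (3.42) member at a coded configuration `c` reads the four letters `η²G′(dec c)`, `∇♯_{base c,k}·η²G′(dec c)`,
`η²G′(dec c)·∇♯_{base c,k}`, `η⁻²Δ_{base c}·η²G′(dec c)` — EXACTLY the U-letters of print.  Hence, unlike the record's W-letter family (which needed the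
`U ↦ U′U` letter conversion of [4] Lemma 2.1, `B9SectBGpTransferConvY`), the U-letter reading is dominated by the augmented one at EVERY coded configuration
with NO conversion, NO threshold and the SAME rate:
* §1 at a fixed `c₀` the members `e ∕ l2 ∕ glob` of `KSCU` ARE those of def-Y's one-configuration reading `kernelFamilyS` with the operator FROZEN at
  `G′(dec c₀)` and the letters along `base` (`rfl`); `KACU`'s Hölder members are nonnegative.
* §2 ★ `eBlock_KSCU_of_KSC` — READ (`B9SectBGpReadingsYProd.hasMajorant_letters_cc_of_eBlock`) then WRITE (`Node00.OpsYRead342.eBlock_kernelFamilyS_of_hasMajorant`)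
  into the frozen reading: `EBlock KSC B₀ δ c → EBlock KSCU (c_R²B₀) δ c`; ★ `globBlock_KSCU_of_eBlock_KSC` — print's remark «(3.47) follows from (3.42)» for the
  frozen reading (g8's `globBlock_kernelFamilyS_of_eBlock`); ★ `KSCU_l2_le_KSC₃`, `l2Block_KSCU_of_KSC₃` — the six U-letter `L²` words are among the augmented
  words of `KSC₃` (`B9SectBL2TransferConvY.kernelFamilyS_l2_le_l2AugS`, member `n ↦ swap34 n`).
* §3 the family-level `hout`s and ★★ `stepEPos_KSCU_on`, ★★ `stepGlobPos_KSCU_on`, ★★ `stepL2Pos_KSCU_on` — three of the seven conjuncts of `SectBStepU`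
  (with §3 of `B9SectBStepsKSCU`, four), by the generic transfers of `B9SectBStepPosFamilyTransfer` ∕ `B9SectBStepL2FamilyTransferPos` from the landed coded
  steps `stepEPos_KSC_on` (g8∕gen 10) and `stepL2Pos_KSC₃_on` (gen 9) with `GA := KACU`, `Cinv := pullS 𝔠 C⁻¹`.
HONEST SCOPE.  Bookkeeping over landed modules plus two finite-dimensional dominations; the `L²` step displays the plaquette law `hplaq` of the regular base
exactly as `B9SectBL2StepRecordOn` does; nothing of [B9] asserted; COUNT-NEUTRAL; N06 NOT discharged; one finite lattice programme — nothing continuum,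
nothing about OS positivity or the mass gap.
-/

noncomputable section

namespace Literature.MathematicalPhysics.QuantumFieldTheory.Balaban1983to89.B9SectBStepsKSCUBlocks

open Literature.MathematicalPhysics.QuantumFieldTheory.Balaban1983to89
open Literature.MathematicalPhysics.QuantumFieldTheory.Balaban1983to89.B6KLevelCensusIndexV1 (KIdx kGeo)
open Literature.MathematicalPhysics.QuantumFieldTheory.Balaban1983to89.B6Ineq2142KLevelV1 (β)
open Literature.MathematicalPhysics.QuantumFieldTheory.Balaban1983to89.B9FromB6 (EBlock L2Block GlobBlock)
open Literature.MathematicalPhysics.QuantumFieldTheory.Balaban1983to89.B9SectBCodedCarrier (CCfg Coding pullK pullS)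
open Literature.MathematicalPhysics.QuantumFieldTheory.Balaban1983to89.B9Eq360DeltaPrimeAY (AfldY)
open Literature.MathematicalPhysics.QuantumFieldTheory.Balaban1983to89.B9PinMembersKLevelV1 (MemberY geo9Y bg9Y)
open Literature.MathematicalPhysics.QuantumFieldTheory.Balaban1983to89.B9SectBGpLettersY (GVal decY)
open Literature.MathematicalPhysics.QuantumFieldTheory.Balaban1983to89.B9SectBGpFrameCodedY (codingYx CplxLettersY)
open Literature.MathematicalPhysics.QuantumFieldTheory.Balaban1983to89.B9SectBGpReadingsY (KSC baseY etaS_eq_eta)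
open Literature.MathematicalPhysics.QuantumFieldTheory.Balaban1983to89.B9SectBGpReadingsYProd (hasMajorant_letters_cc_of_eBlock)
open Literature.MathematicalPhysics.QuantumFieldTheory.Balaban1983to89.B9Ineq347SiteReadingY (globBlock_kernelFamilyS_of_eBlock)
open Literature.MathematicalPhysics.QuantumFieldTheory.Balaban1983to89.B9SectBCodedReadingsU (KSCU KACU)
open Literature.MathematicalPhysics.QuantumFieldTheory.Balaban1983to89.B9SectBStepsKSCU (KACU_members_base ineq342_346_347_congr thms_KSCU_base_iff
  hin_KSCU_on_pos)
open Literature.MathematicalPhysics.QuantumFieldTheory.Balaban1983to89.B9SectBGpTransferInY (ineq343_345_congr)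
open Literature.MathematicalPhysics.QuantumFieldTheory.Balaban1983to89.B9SectBEGlobAnStepRecordOn (stepEPos_KSC_on)
open Literature.MathematicalPhysics.QuantumFieldTheory.Balaban1983to89.B9SectBL2DictionaryY (KSC₃ l2AugS)
open Literature.MathematicalPhysics.QuantumFieldTheory.Balaban1983to89.B9SectBL2TransferConvY (swap34 pref6_swap34 kernelFamilyS_l2_le_l2AugS)
open Literature.MathematicalPhysics.QuantumFieldTheory.Balaban1983to89.B9SectBL2SecondOrderY (PlaqLawY)
open Literature.MathematicalPhysics.QuantumFieldTheory.Balaban1983to89.B9SectBL2StepRecordOn (hin_KSC₃_on_explicit)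
open Literature.MathematicalPhysics.QuantumFieldTheory.Balaban1983to89.B9SectBL2StepCodedOn (stepL2Pos_KSC₃_on)
open Literature.MathematicalPhysics.QuantumFieldTheory.Balaban1983to89.B9SectBStepL2FamilyTransferPos (stepL2Pos_of_family_pos)
open Literature.MathematicalPhysics.QuantumFieldTheory.Balaban1983to89.B9SectBStepPosFamilyTransfer (stepEPos_of_family_pos stepPos_blk_of_family_pos)
open Literature.MathematicalPhysics.QuantumFieldTheory.Balaban1983to89.B9SectBStepWhole (StepEPos StepGlobPos StepL2Pos)
open Literature.MathematicalPhysics.QuantumFieldTheory.Balaban1983to89.B9GeoNormsKLevelV1 (geo9K_wNorm_nonneg)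
open Literature.MathematicalPhysics.QuantumFieldTheory.Balaban1983to89.Node00 (SiteY BlkY IBondY CfgY SiteParY BondParY BondOpY deltaPrimeAY kernelFamilyS
  kernelFamilyB GpY UboxY)
open Literature.MathematicalPhysics.QuantumFieldTheory.Balaban1983to89.Node00.OpsYRead342 (eBlock_kernelFamilyS_of_hasMajorant)
open Literature.MathematicalPhysics.QuantumFieldTheory.Balaban1983to89.Node00.OpsYHolderFar (holderQB_nonneg)

variable {d ℓ : ℕ} {hd : 1 ≤ d + 1} {hL : Odd (ℓ + 1) ∧ 1 < ℓ + 1} {b₀ b₁ : ℝ} {Mstar : ℕ}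
variable {𝔸 : Type} [NormedRing 𝔸] [NormedAlgebra ℂ 𝔸] [CompleteSpace 𝔸] [FiniteDimensional ℝ 𝔸]

/-! ## §1 At a fixed configuration the U-letter members are def-Y's one-configuration reading with the operator frozen -/

section Frozen

variable (G : Subgroup 𝔸ˣ) (x : MemberY d ℓ hd hL b₀ b₁ Mstar) (par : SiteParY 𝔸 x.toKIdx) (OA : BondOpY 𝔸 x.toKIdx) (parB : BondParY 𝔸 x.toKIdx)
  (C37 C38 : ℝ → CfgY 𝔸 x.toKIdx → AfldY 𝔸 x.toKIdx → Prop)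

omit [FiniteDimensional ℝ 𝔸] in
/-- the (3.42) member of `KSCU` at `c₀` IS that of `kernelFamilyS` with the letters along `base` and the operator frozen at `G′(dec c₀)` (`rfl`).
[cite: Balaban1985BackgroundPropagators, (3.42) p.397, p.403 l.1–9, bookkeeping] -/
theorem KSCU_e_eq_frozen (c₀ : (codingYx G x C37 C38).bg.Cfg) (n : Fin 4) :
    (KSCU G x par C37 C38).e n c₀ =
      (kernelFamilyS x.toKIdx (codingYx G x C37 C38).bg (baseY x.toKIdx) (fun _ => GpY x.toKIdx par (decY x.toKIdx c₀)) par).e n c₀ := by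
  funext lam bb
  cases lam <;> rfl

omit [FiniteDimensional ℝ 𝔸] in
/-- the (3.46) member of `KSCU` at `c₀` IS the frozen reading's (`rfl`). [cite: Balaban1985BackgroundPropagators, (3.46) p.398, p.403 l.1–9, bookkeeping] -/
theorem KSCU_l2_eq_frozen (c₀ : (codingYx G x C37 C38).bg.Cfg) (n : Fin 6) :
    (KSCU G x par C37 C38).l2 n c₀ =
      (kernelFamilyS x.toKIdx (codingYx G x C37 C38).bg (baseY x.toKIdx) (fun _ => GpY x.toKIdx par (decY x.toKIdx c₀)) par).l2 n c₀ := by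
  funext lam h
  cases lam <;> cases h <;> rfl

omit [FiniteDimensional ℝ 𝔸] in
/-- the (3.47) member of `KSCU` at `c₀` IS the frozen reading's (`rfl`). [cite: Balaban1985BackgroundPropagators, (3.47) p.398, p.403 l.1–9, bookkeeping] -/
theorem KSCU_glob_eq_frozen (c₀ : (codingYx G x C37 C38).bg.Cfg) (n : Fin 4) :
    (KSCU G x par C37 C38).glob n c₀ =
      (kernelFamilyS x.toKIdx (codingYx G x C37 C38).bg (baseY x.toKIdx) (fun _ => GpY x.toKIdx par (decY x.toKIdx c₀)) par).glob n c₀ := by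
  funext lam γ
  cases lam <;> rfl

omit [FiniteDimensional ℝ 𝔸] in
/-- the Hölder members (3.43)–(3.45) of the bond-sector reading `KACU` are nonnegative (sups of norms ∕ Hölder quotients, `0` off the bond sector).
[cite: Balaban1985BackgroundPropagators, (3.43)–(3.45) p.398, (3.40) p.397, bookkeeping] -/
theorem KACU_holder_nonneg (c : (codingYx G x C37 C38).bg.Cfg) :
    (∀ lam β' ζ, 0 ≤ (KACU G x OA parB C37 C38).h1 c lam β' ζ) ∧ (∀ lam y, 0 ≤ (KACU G x OA parB C37 C38).e4 c lam y) ∧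
      (∀ lam β' ζ, 0 ≤ (KACU G x OA parB C37 C38).h2 c lam β' ζ) := by
  refine ⟨fun lam β' ζ => ?_, fun lam y => ?_, fun lam β' ζ => ?_⟩
  · rcases lam with f | J <;> rcases ζ with z | z
    · exact le_rfl
    · exact le_rfl
    · exact le_rfl
    · exact Real.iSup_nonneg fun E => le_max_of_le_left (Real.iSup_nonneg fun ν => holderQB_nonneg _ _ _ _ _)
  · rcases lam with f | J
    · exact le_rfl
    · exact Real.iSup_nonneg fun E => Real.iSup_nonneg fun ν => Real.iSup_nonneg fun μ => Real.iSup_nonneg fun w => norm_nonneg _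
  · rcases lam with f | J <;> rcases ζ with z | z
    · exact le_rfl
    · exact le_rfl
    · exact le_rfl
    · exact Real.iSup_nonneg fun E => Real.iSup_nonneg fun ν => Real.iSup_nonneg fun μ => holderQB_nonneg _ _ _ _ _

end Frozen

/-! ## §2 The dominations at one coded configuration: (3.42) by READ∕WRITE, (3.47) from (3.42), (3.46) among the augmented words -/

section Dominate

variable (G : Subgroup 𝔸ˣ) (x : MemberY d ℓ hd hL b₀ b₁ Mstar) (par : SiteParY 𝔸 x.toKIdx) {ι : Type} [Fintype ι] (b : Module.Basis ι ℝ 𝔸)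
  (ιB : BlkY x.toKIdx → IBondY x.toKIdx) (C37 C38 : ℝ → CfgY 𝔸 x.toKIdx → AfldY 𝔸 x.toKIdx → Prop)

/-- ★ **THE FROZEN READING's (3.42) BLOCK FROM THE AUGMENTED ONE, SAME CONFIGURATION, SAME RATE**: `EBlock KSC B₀ δ c` (`B₀ ≧ 0`) gives the (3.42) block
of `kernelFamilyS … base (G′(dec c) frozen) par` at `c` with constant `c_R·(c_R·B₀)`, `c_R = M₂Σ‖b_j‖` — READ the four U-letter block majorants
(`hasMajorant_letters_cc_of_eBlock`), WRITE them (`eBlock_kernelFamilyS_of_hasMajorant`, letters `UboxY (base c)`); no letter conversion.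
[cite: Balaban1985BackgroundPropagators, (3.42) p.397, p.403 l.1–9; Balaban1984PropagatorsII, (2.51)–(2.52) p.232] -/
theorem eBlock_frozen_of_KSC [Fintype (geo9Y x).Site] (hι : ∀ s : BlkY x.toKIdx, β x.toKIdx.hN x.toKIdx.D x.toKIdx.hk (ιB s) = s)
    {M₂ : ℝ} (hM₂ : 0 ≤ M₂) (hrepr : ∀ (v : 𝔸) (j : ι), |b.repr v j| ≤ M₂ * ‖v‖)
    {c : (codingYx G x C37 C38).bg.Cfg} {B₀ δ : ℝ} (hB₀ : 0 ≤ B₀) (hE : EBlock (KSC G x par C37 C38) B₀ δ c) :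
    EBlock (kernelFamilyS x.toKIdx (codingYx G x C37 C38).bg (baseY x.toKIdx) (fun _ => GpY x.toKIdx par (decY x.toKIdx c)) par)
      (M₂ * (∑ j, ‖b j‖) * (M₂ * (∑ j, ‖b j‖) * B₀)) δ c := by
  obtain ⟨h0, h1, h2, h3⟩ := hasMajorant_letters_cc_of_eBlock G x par b ιB C37 C38 (Rr := (0 : ℝ)) (Hp := True) hι M₂ hM₂ hrepr hB₀ hE
  have hSb : 0 ≤ ∑ j, ‖b j‖ := Finset.sum_nonneg fun j _ => norm_nonneg _
  have hBin : 0 ≤ M₂ * (∑ j, ‖b j‖) * B₀ := mul_nonneg (mul_nonneg hM₂ hSb) hB₀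
  letI : Fintype (B9GeoNormsKLevelV1.geo9K x.toKIdx).Site := ‹Fintype (geo9Y x).Site›
  exact eBlock_kernelFamilyS_of_hasMajorant x.toKIdx b (B := (codingYx G x C37 C38).bg) (cfg := baseY x.toKIdx)
    (O := fun _ => GpY x.toKIdx par (decY x.toKIdx c)) (par := par) (U₁ := c) (Rr := (0 : ℝ)) (Hp := True) ιB hι hM₂ hrepr
    (η := (kGeo x.toKIdx).eta) (by rw [etaS_eq_eta]) (Uc := UboxY x.toKIdx (baseY x.toKIdx c)) rfl
    (((kGeo x.toKIdx).eta ^ 2) • (GpY x.toKIdx par (decY x.toKIdx c)).restrictScalars ℝ)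
    ((((kGeo x.toKIdx).eta ^ 2))⁻¹ • (Node00.lapSL x.toKIdx (baseY x.toKIdx c)).restrictScalars ℝ)
    (fun Λ' => rfl) (fun Λ' => by rw [LinearMap.smul_apply, LinearMap.restrictScalars_apply, Node00.lapSL_apply]) hBin
    h0 (fun μ => h1 (Sum.inl μ)) (fun μ => h2 (Sum.inr μ)) h3

/-- ★ **THE U-LETTER (3.42) BLOCK FROM THE AUGMENTED ONE, AT EVERY CODED CONFIGURATION, SAME RATE**: `EBlock KSC B₀ δ c → EBlock KSCU (c_R²·B₀) δ c`.
[cite: Balaban1985BackgroundPropagators, (3.42) p.397, Thm 3.4 p.400, p.403 l.1–9; Balaban1984PropagatorsII, (2.51)–(2.52) p.232] -/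
theorem eBlock_KSCU_of_KSC [Fintype (geo9Y x).Site] (hι : ∀ s : BlkY x.toKIdx, β x.toKIdx.hN x.toKIdx.D x.toKIdx.hk (ιB s) = s)
    {M₂ : ℝ} (hM₂ : 0 ≤ M₂) (hrepr : ∀ (v : 𝔸) (j : ι), |b.repr v j| ≤ M₂ * ‖v‖)
    {c : (codingYx G x C37 C38).bg.Cfg} {B₀ δ : ℝ} (hB₀ : 0 ≤ B₀) (hE : EBlock (KSC G x par C37 C38) B₀ δ c) :
    EBlock (KSCU G x par C37 C38) (M₂ * (∑ j, ‖b j‖) * (M₂ * (∑ j, ‖b j‖) * B₀)) δ c := by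
  have hw := eBlock_frozen_of_KSC G x par b ιB C37 C38 hι hM₂ hrepr hB₀ hE
  intro n lam y y' hs
  rw [KSCU_e_eq_frozen]
  exact hw n lam y y' hs

/-- ★ **THE U-LETTER (3.47) BLOCK FROM THE AUGMENTED (3.42) BLOCK, ONE THRESHOLD PER RATE**: for `δ > 0` there are `Mg`, `Cg ≧ 0` (g8's
`globBlock_kernelFamilyS_of_eBlock`: [4] Lemma 2.1 on the window `{δ} × [1/2, 1]`) such that above `Mg`, at every coded `c` and `B₀ ≧ 0`:
`EBlock KSC B₀ δ c → GlobBlock KSCU (c_R²·B₀·Cg) c` — print's remark «(3.47) follows from (3.42)» for the frozen reading.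
[cite: Balaban1985BackgroundPropagators, (3.47) p.398 + p.398 first remark, (3.42) p.397, p.403 l.1–9; Balaban1984PropagatorsII, Lemma 2.1 (2.60)–(2.61) p.234] -/
theorem globBlock_KSCU_of_eBlock_KSC [∀ x : MemberY d ℓ hd hL b₀ b₁ Mstar, Fintype (geo9Y x).Site] {δ : ℝ} (hδ : 0 < δ)
    {M₂ : ℝ} (hM₂ : 0 ≤ M₂) (hrepr : ∀ (v : 𝔸) (j : ι), |b.repr v j| ≤ M₂ * ‖v‖) :
    ∃ Mg Cg : ℝ, 0 ≤ Cg ∧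
      ∀ (x : MemberY d ℓ hd hL b₀ b₁ Mstar) (ιB : BlkY x.toKIdx → IBondY x.toKIdx),
        (∀ s : BlkY x.toKIdx, β x.toKIdx.hN x.toKIdx.D x.toKIdx.hk (ιB s) = s) → Mg ≤ (geo9Y x).M →
        ∀ (par : SiteParY 𝔸 x.toKIdx) (C37 C38 : ℝ → CfgY 𝔸 x.toKIdx → AfldY 𝔸 x.toKIdx → Prop) (c : (codingYx G x C37 C38).bg.Cfg) (B₀ : ℝ),
          0 ≤ B₀ → EBlock (KSC G x par C37 C38) B₀ δ c → GlobBlock (KSCU G x par C37 C38) (M₂ * (∑ j, ‖b j‖) * (M₂ * (∑ j, ‖b j‖) * B₀) * Cg) c := by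
  obtain ⟨Mg, Cg, hCg, HG⟩ := globBlock_kernelFamilyS_of_eBlock (d := d) (ℓ := ℓ) (hd := hd) (hL := hL) (b₀ := b₀) (b₁ := b₁) (Mstar := Mstar)
    (𝔸 := 𝔸) hδ
  refine ⟨Mg, Cg, hCg, fun x ιB hι hM par C37 C38 c B₀ hB₀ hE => ?_⟩
  have hSb : 0 ≤ ∑ j, ‖b j‖ := Finset.sum_nonneg fun j _ => norm_nonneg _
  have hfz := eBlock_frozen_of_KSC G x par b ιB C37 C38 hι hM₂ hrepr hB₀ hE
  have hglob := HG x ιB hι hM (codingYx G x C37 C38).bg (baseY x.toKIdx) (fun _ => GpY x.toKIdx par (decY x.toKIdx c)) par c _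
    (mul_nonneg (mul_nonneg hM₂ hSb) (mul_nonneg (mul_nonneg hM₂ hSb) hB₀)) hfz
  intro n lam γ hγ₁ hγ₂
  rw [KSCU_glob_eq_frozen]
  exact hglob n lam γ hγ₁ hγ₂

/-- ★ **THE SIX U-LETTER `L²` MEMBERS ARE AMONG THE AUGMENTED WORDS OF `KSC₃`**: member `n` of `KSCU` at `c` ≦ member `swap34 n` of `KSC₃` at `c` (both read
the words with differences at `base c` and the operator `G′(dec c)`; print's 4th∕5th quantities are the frames' members in the other order).
[cite: Balaban1985BackgroundPropagators, Thm 3.1 (3.46) p.398, p.398 (first remark after Thm 3.1), p.403 l.1–9] -/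
theorem KSCU_l2_le_KSC₃ (c : (codingYx G x C37 C38).bg.Cfg) (n : Fin 6) (lam : (geo9Y x).Loc) (h : (geo9Y x).Cut) :
    (KSCU G x par C37 C38).l2 n c lam h ≤ (KSC₃ G x par C37 C38).l2 (swap34 n) c lam h := by
  rw [KSCU_l2_eq_frozen]
  have hle := kernelFamilyS_l2_le_l2AugS x (B := (codingYx G x C37 C38).bg) (baseY x.toKIdx) (fun _ => GpY x.toKIdx par (decY x.toKIdx c)) par n c lam h
  have heq : l2AugS x.toKIdx (B := (codingYx G x C37 C38).bg) (fun c' => CCfg.base (baseY x.toKIdx c')) (fun _ => GpY x.toKIdx par (decY x.toKIdx c))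
      (swap34 n) c lam h = (KSC₃ G x par C37 C38).l2 (swap34 n) c lam h := by
    cases lam <;> cases h <;> rfl
  exact hle.trans_eq heq

/-- ★ **THE U-LETTER (3.46) BLOCK FROM THE AUGMENTED ONE, SAME CONFIGURATION, SAME CONSTANTS.** [cite: Balaban1985BackgroundPropagators, Thm 3.1 (3.46) p.398, Thm 3.4 p.400, p.403 l.1–9] -/
theorem l2Block_KSCU_of_KSC₃ {c : (codingYx G x C37 C38).bg.Cfg} {B₀ δ : ℝ} (hL2 : L2Block (KSC₃ G x par C37 C38) B₀ δ c) :
    L2Block (KSCU G x par C37 C38) B₀ δ c := by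
  intro n lam hh y y' hcut hsupp
  have h1 := hL2 (swap34 n) lam hh y y' hcut hsupp
  rw [pref6_swap34] at h1
  exact (KSCU_l2_le_KSC₃ G x par C37 C38 c n lam hh).trans h1

end Dominate

/-! ## §3 The family-level output dominations and the three block-steps of `(KSCU, KACU, C⁻¹)` -/

section Steps

variable {J : Type} (f : J → MemberY d ℓ hd hL b₀ b₁ Mstar) [∀ x : MemberY d ℓ hd hL b₀ b₁ Mstar, Fintype (geo9Y x).Site]
  (c35 : ℝ) (G : Subgroup 𝔸ˣ) (par : ∀ j : J, SiteParY 𝔸 (f j).toKIdx) (OA : ∀ j : J, BondOpY 𝔸 (f j).toKIdx)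
  (parB : ∀ j : J, BondParY 𝔸 (f j).toKIdx) {ι : Type} [Fintype ι] (b : Module.Basis ι ℝ 𝔸)
  (ιB : ∀ j : J, BlkY (f j).toKIdx → IBondY (f j).toKIdx)
  (C37 C38 : ∀ j : J, ℝ → CfgY 𝔸 (f j).toKIdx → AfldY 𝔸 (f j).toKIdx → Prop)
  (Cinv : ∀ j : J, B9.SiteKernel (geo9Y (f j)) (bg9Y 𝔸 G (f j)))

/-- ★ **THE (3.42) OUTPUT DOMINATION FOR `KSCU`, NO THRESHOLD, SAME RATE** (input `KSC`'s block at the product, output `KSCU`'s with `c_R²·B`).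
[cite: Balaban1985BackgroundPropagators, (3.42) p.397, Thm 3.4 p.400, p.403 l.1–9] -/
theorem houtE_KSCU_on (hι : ∀ (j : J) (s : BlkY (f j).toKIdx), β (f j).toKIdx.hN (f j).toKIdx.D (f j).toKIdx.hk (ιB j s) = s)
    {M₂ : ℝ} (hM₂ : 0 ≤ M₂) (hrepr : ∀ (v : 𝔸) (j : ι), |b.repr v j| ≤ M₂ * ‖v‖) (hcR : 0 < M₂ * ∑ j, ‖b j‖) :
    ∀ (B δ a : ℝ), 0 < B → 0 < δ → 0 < a →
      ∃ (Mo ao a' B' δ' : ℝ), 0 < ao ∧ 0 < a' ∧ a' ≤ a ∧ 0 < B' ∧ 0 < δ' ∧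
        ∀ j : J, Mo ≤ (geo9Y (f j)).M → ∀ α₀ : ℝ, 0 < α₀ → (geo9Y (f j)).M * α₀ ≤ ao →
          ∀ c : (codingYx G (f j) (C37 j) (C38 j)).bg.Cfg, (codingYx G (f j) (C37 j) (C38 j)).bg.Reg335 c35 α₀ c →
          ∀ α₁ : ℝ, 0 < α₁ → α₁ ≤ a' → ∀ c' : (codingYx G (f j) (C37 j) (C38 j)).bg.Cfg, (codingYx G (f j) (C37 j) (C38 j)).bg.Cplx337 α₁ c c' →
          EBlock (KSC G (f j) (par j) (C37 j) (C38 j)) B δ ((codingYx G (f j) (C37 j) (C38 j)).bg.mul c' c) →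
          EBlock (KSCU G (f j) (par j) (C37 j) (C38 j)) B' δ' ((codingYx G (f j) (C37 j) (C38 j)).bg.mul c' c) :=
  fun B δ a hB hδ ha => ⟨0, 1, a, M₂ * (∑ j, ‖b j‖) * (M₂ * (∑ j, ‖b j‖) * B), δ, one_pos, ha, le_rfl, mul_pos hcR (mul_pos hcR hB), hδ,
    fun j _ _ _ _ _ _ _ _ _ _ _ hE => eBlock_KSCU_of_KSC G (f j) (par j) b (ιB j) (C37 j) (C38 j) (hι j) hM₂ hrepr hB.le hE⟩

/-- ★ **THE (3.47) OUTPUT RECOVERED FROM THE (3.42) OUTPUT FOR `KSCU`** (threshold `Mg(δ)` of g8's Lemma-2.1 window; constant `max (c_R²·B·Cg) 1`).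
[cite: Balaban1985BackgroundPropagators, (3.47) p.398 + p.398 first remark, Thm 3.4 p.400, p.403 l.1–9; Balaban1984PropagatorsII, Lemma 2.1 p.234] -/
theorem houtEGlob_KSCU_on (hι : ∀ (j : J) (s : BlkY (f j).toKIdx), β (f j).toKIdx.hN (f j).toKIdx.D (f j).toKIdx.hk (ιB j s) = s)
    {M₂ : ℝ} (hM₂ : 0 ≤ M₂) (hrepr : ∀ (v : 𝔸) (j : ι), |b.repr v j| ≤ M₂ * ‖v‖) :
    ∀ (B δ a : ℝ), 0 < B → 0 < δ → 0 < a →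
      ∃ (Mo ao a' B' : ℝ), 0 < ao ∧ 0 < a' ∧ a' ≤ a ∧ 0 < B' ∧
        ∀ j : J, Mo ≤ (geo9Y (f j)).M → ∀ α₀ : ℝ, 0 < α₀ → (geo9Y (f j)).M * α₀ ≤ ao →
          ∀ c : (codingYx G (f j) (C37 j) (C38 j)).bg.Cfg, (codingYx G (f j) (C37 j) (C38 j)).bg.Reg335 c35 α₀ c →
          ∀ α₁ : ℝ, 0 < α₁ → α₁ ≤ a' → ∀ c' : (codingYx G (f j) (C37 j) (C38 j)).bg.Cfg, (codingYx G (f j) (C37 j) (C38 j)).bg.Cplx337 α₁ c c' →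
          EBlock (KSC G (f j) (par j) (C37 j) (C38 j)) B δ ((codingYx G (f j) (C37 j) (C38 j)).bg.mul c' c) →
          GlobBlock (KSCU G (f j) (par j) (C37 j) (C38 j)) B' ((codingYx G (f j) (C37 j) (C38 j)).bg.mul c' c) := by
  intro B δ a hB hδ ha
  obtain ⟨Mg, Cg, -, HG⟩ := globBlock_KSCU_of_eBlock_KSC (d := d) (ℓ := ℓ) (hd := hd) (hL := hL) (b₀ := b₀) (b₁ := b₁) (Mstar := Mstar) G b hδ hM₂ hrepr
  refine ⟨Mg, 1, a, max (M₂ * (∑ j, ‖b j‖) * (M₂ * (∑ j, ‖b j‖) * B) * Cg) 1, one_pos, ha, le_rfl, lt_max_of_lt_right one_pos,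
    fun j hM _ _ _ _ _ _ _ _ _ _ hE => ?_⟩
  have hglob := HG (f j) (ιB j) (hι j) hM (par j) (C37 j) (C38 j) _ B hB.le hE
  intro n lam γ hγ₁ hγ₂
  exact (hglob n lam γ hγ₁ hγ₂).trans (mul_le_mul_of_nonneg_right (le_max_left _ _) (geo9K_wNorm_nonneg (f j).toKIdx γ lam))

omit [∀ x : MemberY d ℓ hd hL b₀ b₁ Mstar, Fintype (geo9Y x).Site] in
/-- ★ **THE (3.46) OUTPUT DOMINATION FOR `KSCU`, NO THRESHOLD, SAME CONSTANTS** (input `KSC₃`'s block at the product).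
[cite: Balaban1985BackgroundPropagators, Thm 3.1 (3.46) p.398, Thm 3.4 p.400, p.403 l.1–9] -/
theorem houtL2_KSCU_on :
    ∀ (B δ a : ℝ), 0 < B → 0 < δ → 0 < a →
      ∃ (Mo ao a' B' δ' : ℝ), 0 < ao ∧ 0 < a' ∧ a' ≤ a ∧ 0 < B' ∧ 0 < δ' ∧
        ∀ j : J, Mo ≤ (geo9Y (f j)).M → ∀ α₀ : ℝ, 0 < α₀ → (geo9Y (f j)).M * α₀ ≤ ao →
          ∀ c : (codingYx G (f j) (C37 j) (C38 j)).bg.Cfg, (codingYx G (f j) (C37 j) (C38 j)).bg.Reg335 c35 α₀ c →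
          ∀ α₁ : ℝ, 0 < α₁ → α₁ ≤ a' → ∀ c' : (codingYx G (f j) (C37 j) (C38 j)).bg.Cfg, (codingYx G (f j) (C37 j) (C38 j)).bg.Cplx337 α₁ c c' →
          L2Block (KSC₃ G (f j) (par j) (C37 j) (C38 j)) B δ ((codingYx G (f j) (C37 j) (C38 j)).bg.mul c' c) →
          L2Block (KSCU G (f j) (par j) (C37 j) (C38 j)) B' δ' ((codingYx G (f j) (C37 j) (C38 j)).bg.mul c' c) :=
  fun B δ a hB hδ ha => ⟨0, 1, a, B, δ, one_pos, ha, le_rfl, hB, hδ, fun j _ _ _ _ _ _ _ _ _ _ _ hL2 => l2Block_KSCU_of_KSC₃ G (f j) (par j) (C37 j) (C38 j) hL2⟩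

/-- ★★ **`StepEPos` OF `KSCU` over the coded carrier** (input families `(KSCU, KACU, pullS C⁻¹)`; output `KSCU`'s (3.42) block at the product): the coded step
`stepEPos_KSC_on` (with `GA := KACU`, `Cinv := pullS C⁻¹`) transported by `stepEPos_of_family_pos` — `hin_KSCU_on_pos`, `houtE_KSCU_on`.
Displayed: the root frame's structural data (as `B9SectBEGlobAnStepRecordOn`); no plaquette law, no class implication (we stay over the coded carrier).
[cite: Balaban1985BackgroundPropagators, Thm 3.1 (3.42) p.397, Thm 3.4 p.400, (3.60)–(3.64) p.402, p.403 l.1–9, (3.35)–(3.37) p.396; Balaban1984PropagatorsII, Lemma 2.1 p.234, (2.51) p.232] -/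
theorem stepEPos_KSCU_on [∀ x : MemberY d ℓ hd hL b₀ b₁ Mstar, DecidableEq (geo9Y x).Site] [∀ x : MemberY d ℓ hd hL b₀ b₁ Mstar, Nonempty (geo9Y x).Site]
    [NormOneClass 𝔸] [DecidableEq ι]
    (hι : ∀ (j : J) (s : BlkY (f j).toKIdx), β (f j).toKIdx.hN (f j).toKIdx.D (f j).toKIdx.hk (ιB j s) = s)
    (hG1 : ∀ u : 𝔸ˣ, u ∈ G → ‖(u : 𝔸)‖ ≤ 1) (hpar : ∀ j (U : CfgY 𝔸 (f j).toKIdx), GVal G (f j).toKIdx U → ∀ z w, par j U z w ∈ G)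
    (hunit : ∀ j (U : CfgY 𝔸 (f j).toKIdx), GVal G (f j).toKIdx U → IsUnit (deltaPrimeAY (f j).toKIdx (par j) U))
    (dB : ℕ) (M₂ : ℝ) (hM₂ : 0 ≤ M₂) (hrepr : ∀ (v : 𝔸) (j : ι), |b.repr v j| ≤ M₂ * ‖v‖) (hcR : 0 < M₂ * ∑ j, ‖b j‖)
    (Cq : ℝ) (hCq : 0 ≤ Cq) (hC37 : ∀ j β' U a, C37 j β' U a → GVal G (f j).toKIdx U ∧ CplxLettersY G (f j) (par j) (ιB j) Cq β' U a)
    (MInv aInv aW : ℝ) (hMInv : 0 < MInv) (haInv : 0 < aInv) (haW : 0 < aW) :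
    StepEPos dB c35 (fun j => geo9Y (f j)) (fun j => (codingYx G (f j) (C37 j) (C38 j)).bg)
      (fun j => KSCU G (f j) (par j) (C37 j) (C38 j)) (fun j => KACU G (f j) (OA j) (parB j) (C37 j) (C38 j))
      (fun j => pullS (codingYx G (f j) (C37 j) (C38 j)) (Cinv j)) (fun j => KSCU G (f j) (par j) (C37 j) (C38 j)) :=
  stepEPos_of_family_pos dB c35 (fun j => geo9Y (f j)) (fun j => (codingYx G (f j) (C37 j) (C38 j)).bg)
    (fun j => KSC G (f j) (par j) (C37 j) (C38 j)) (fun j => KSCU G (f j) (par j) (C37 j) (C38 j))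
    (fun j => KACU G (f j) (OA j) (parB j) (C37 j) (C38 j)) (fun j => KACU G (f j) (OA j) (parB j) (C37 j) (C38 j))
    (fun j => pullS (codingYx G (f j) (C37 j) (C38 j)) (Cinv j))
    (fun j => KSC G (f j) (par j) (C37 j) (C38 j)) (fun j => KSCU G (f j) (par j) (C37 j) (C38 j))
    (hin_KSCU_on_pos f c35 G par OA parB b ιB C37 C38 Cinv hι hG1 hM₂ hrepr dB)
    (houtE_KSCU_on f c35 G par b ιB C37 C38 hι hM₂ hrepr hcR)
    (stepEPos_KSC_on f c35 G par b ιB C37 C38 hι hG1 hpar hunit dB M₂ hM₂ hrepr hcR Cq hCq hC37 MInv aInv aW hMInv haInv haW _ _)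

/-- ★★ **`StepGlobPos` OF `KSCU` over the coded carrier** — the (3.47) block at the product recovered from the coded (3.42) step by the generic transfer with
CHANGED output statement (`stepPos_blk_of_family_pos`: `EBlock KSC ↦ GlobBlock KSCU`, `houtEGlob_KSCU_on`).
[cite: Balaban1985BackgroundPropagators, Thm 3.1 (3.47) p.398 + p.398 first remark, Thm 3.4 p.400, p.402 («all the statements (3.42)–(3.47) for G′(U′U)»), p.403 l.1–9; Balaban1984PropagatorsII, Lemma 2.1 p.234] -/
theorem stepGlobPos_KSCU_on [∀ x : MemberY d ℓ hd hL b₀ b₁ Mstar, DecidableEq (geo9Y x).Site] [∀ x : MemberY d ℓ hd hL b₀ b₁ Mstar, Nonempty (geo9Y x).Site]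
    [NormOneClass 𝔸] [DecidableEq ι]
    (hι : ∀ (j : J) (s : BlkY (f j).toKIdx), β (f j).toKIdx.hN (f j).toKIdx.D (f j).toKIdx.hk (ιB j s) = s)
    (hG1 : ∀ u : 𝔸ˣ, u ∈ G → ‖(u : 𝔸)‖ ≤ 1) (hpar : ∀ j (U : CfgY 𝔸 (f j).toKIdx), GVal G (f j).toKIdx U → ∀ z w, par j U z w ∈ G)
    (hunit : ∀ j (U : CfgY 𝔸 (f j).toKIdx), GVal G (f j).toKIdx U → IsUnit (deltaPrimeAY (f j).toKIdx (par j) U))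
    (dB : ℕ) (M₂ : ℝ) (hM₂ : 0 ≤ M₂) (hrepr : ∀ (v : 𝔸) (j : ι), |b.repr v j| ≤ M₂ * ‖v‖) (hcR : 0 < M₂ * ∑ j, ‖b j‖)
    (Cq : ℝ) (hCq : 0 ≤ Cq) (hC37 : ∀ j β' U a, C37 j β' U a → GVal G (f j).toKIdx U ∧ CplxLettersY G (f j) (par j) (ιB j) Cq β' U a)
    (MInv aInv aW : ℝ) (hMInv : 0 < MInv) (haInv : 0 < aInv) (haW : 0 < aW) :
    StepGlobPos dB c35 (fun j => geo9Y (f j)) (fun j => (codingYx G (f j) (C37 j) (C38 j)).bg)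
      (fun j => KSCU G (f j) (par j) (C37 j) (C38 j)) (fun j => KACU G (f j) (OA j) (parB j) (C37 j) (C38 j))
      (fun j => pullS (codingYx G (f j) (C37 j) (C38 j)) (Cinv j)) (fun j => KSCU G (f j) (par j) (C37 j) (C38 j)) := by
  refine stepPos_blk_of_family_pos dB c35 (fun j => geo9Y (f j)) (fun j => (codingYx G (f j) (C37 j) (C38 j)).bg)
    (fun j => KSC G (f j) (par j) (C37 j) (C38 j)) (fun j => KSCU G (f j) (par j) (C37 j) (C38 j))
    (fun j => KACU G (f j) (OA j) (parB j) (C37 j) (C38 j)) (fun j => KACU G (f j) (OA j) (parB j) (C37 j) (C38 j))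
    (fun j => pullS (codingYx G (f j) (C37 j) (C38 j)) (Cinv j))
    (C₁ := ℝ × ℝ) (C₂ := ℝ) (pos₁ := fun c => 0 < c.1 ∧ 0 < c.2) (pos₂ := fun c => 0 < c)
    (Blk₁ := fun c j W => EBlock (KSC G (f j) (par j) (C37 j) (C38 j)) c.1 c.2 W)
    (Blk₂ := fun c j W => GlobBlock (KSCU G (f j) (par j) (C37 j) (C38 j)) c W)
    (hin_KSCU_on_pos f c35 G par OA parB b ιB C37 C38 Cinv hι hG1 hM₂ hrepr dB) (fun c hc a ha => ?_)
    (stepEPos_KSC_on f c35 G par b ιB C37 C38 hι hG1 hpar hunit dB M₂ hM₂ hrepr hcR Cq hCq hC37 MInv aInv aW hMInv haInv haW _ _)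
  obtain ⟨Mo, ao, a', B', hao, ha', ha'a, hB', H⟩ := houtEGlob_KSCU_on f c35 G par b ιB C37 C38 hι hM₂ hrepr c.1 c.2 a hc.1 hc.2 ha
  exact ⟨Mo, ao, a', B', hao, ha', ha'a, hB', H⟩

/-- ★ **`hin` FOR THE `L²` STEP WITH POSITIVE OUTPUT CONSTANTS** (input families `(KSCU, KACU, pullS C⁻¹)`; output `KSC₃` with the shared `KACU`, `pullS C⁻¹`):
at a (3.35)-regular base the block is the record's read along the decoding (`thms_KSCU_base_iff`), then `B9SectBL2StepRecordOn.hin_KSC₃_on_explicit` (the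
augmented (3.46) member under the plaquette law of the regular base); `KACU`'s Hölder members are nonnegative (§1).
[cite: Balaban1985BackgroundPropagators, Thms 3.1–3.3 (3.42)–(3.48) pp.397–399, (3.35) p.396, p.398 (first remark), p.404 (after (3.69)); Balaban1984PropagatorsII, Lemma 2.1 p.234] -/
theorem hin_KSCU₃_on_pos [∀ x : MemberY d ℓ hd hL b₀ b₁ Mstar, DecidableEq (geo9Y x).Site] [DecidableEq ι]
    (hι : ∀ (j : J) (s : BlkY (f j).toKIdx), β (f j).toKIdx.hN (f j).toKIdx.D (f j).toKIdx.hk (ιB j s) = s)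
    (hG1 : ∀ u : 𝔸ˣ, u ∈ G → ‖(u : 𝔸)‖ ≤ 1) {M₂ : ℝ} (hM₂ : 0 ≤ M₂) (hrepr : ∀ (v : 𝔸) (j : ι), |b.repr v j| ≤ M₂ * ‖v‖) (dC : ℕ)
    {cP : ℝ} (hcP : 0 ≤ cP)
    (hplaq : ∀ (j : J) (α₀ : ℝ) (U : CfgY 𝔸 (f j).toKIdx), (bg9Y 𝔸 G (f j)).Reg335 c35 α₀ U → PlaqLawY (f j) (ιB j) cP U) :
    ∀ (B₀ δ₀ : ℝ) (Bβ Bε : ℝ → ℝ) (Bεβ : ℝ → ℝ → ℝ) (B₁ δ₁ : ℝ), 0 < B₀ → 0 < δ₀ → 0 < B₁ → 0 < δ₁ →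
      ∃ (Mi ai B₀' δ₀' : ℝ) (Bβ' Bε' : ℝ → ℝ) (Bεβ' : ℝ → ℝ → ℝ) (B₁' δ₁' : ℝ), 0 < ai ∧ 0 < B₀' ∧ 0 < δ₀' ∧ 0 < B₁' ∧ 0 < δ₁' ∧
        ∀ j : J, Mi ≤ (geo9Y (f j)).M → ∀ α₀ : ℝ, 0 < α₀ → (geo9Y (f j)).M * α₀ ≤ ai →
          ∀ c : (codingYx G (f j) (C37 j) (C38 j)).bg.Cfg, (codingYx G (f j) (C37 j) (C38 j)).bg.Reg335 c35 α₀ c →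
          B9.Thms31to33IneqAt dC (KSCU G (f j) (par j) (C37 j) (C38 j)) (KACU G (f j) (OA j) (parB j) (C37 j) (C38 j))
              (pullS (codingYx G (f j) (C37 j) (C38 j)) (Cinv j)) B₀ δ₀ Bβ Bε Bεβ B₁ δ₁ c →
          B9.Thms31to33IneqAt dC (KSC₃ G (f j) (par j) (C37 j) (C38 j)) (KACU G (f j) (OA j) (parB j) (C37 j) (C38 j))
              (pullS (codingYx G (f j) (C37 j) (C38 j)) (Cinv j)) B₀' δ₀' Bβ' Bε' Bεβ' B₁' δ₁' c := by
  intro B₀ δ₀ Bβ Bε Bεβ B₁ δ₁ hB₀ hδ₀ hB₁ hδ₁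
  obtain ⟨Mi, ai, B₀', δ₀', Bβ', Bε', Bεβ', B₁', δ₁', hai, hB₀', hδ₀', hB₁', hδ₁', H⟩ :=
    hin_KSC₃_on_explicit f c35 G par b ιB C37 C38 hι hG1 hM₂ hrepr dC (fun j => KACU G (f j) (OA j) (parB j) (C37 j) (C38 j))
      (fun j => pullS (codingYx G (f j) (C37 j) (C38 j)) (Cinv j)) (fun j c => KACU_holder_nonneg G (f j) (OA j) (parB j) (C37 j) (C38 j) c)
      hcP hplaq B₀ δ₀ Bβ Bε Bεβ B₁ δ₁ hB₀ hδ₀ hB₁ hδ₁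
  refine ⟨Mi, ai, B₀', δ₀', Bβ', Bε', Bεβ', B₁', δ₁', hai, hB₀', hδ₀', hB₁', hδ₁', fun j hM α₀ hα₀ hMa c hreg hT => ?_⟩
  obtain ⟨U, rfl, -⟩ := (codingYx G (f j) (C37 j) (C38 j)).exists_of_bg_Reg335 hreg
  refine H j hM α₀ hα₀ hMa _ hreg ?_
  obtain ⟨⟨h42, h43⟩, hC, ⟨g42, g43⟩⟩ := (thms_KSCU_base_iff G (f j) (par j) (OA j) (parB j) (C37 j) (C38 j) dC (Cinv j) B₀ δ₀ Bβ Bε Bεβ B₁ δ₁ U).1 hT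
  obtain ⟨ae, ah1, ae4, ah2, al2, ag⟩ := KACU_members_base G (f j) (OA j) (parB j) (C37 j) (C38 j) U
  exact ⟨⟨h42, h43⟩, hC, ⟨ineq342_346_347_congr G (f j) (C37 j) (C38 j) _ _ (fun n => (ae n).symm) (fun n => (al2 n).symm)
    (fun n => (ag n).symm) B₀ δ₀ g42, ineq343_345_congr G (f j) (C37 j) (C38 j) _ _ ah1.symm ae4.symm ah2.symm Bβ Bε Bεβ δ₀ g43⟩⟩

/-- ★★ **`StepL2Pos` OF `KSCU` over the coded carrier** (all six (3.46) members; input families `(KSCU, KACU, pullS C⁻¹)`): the coded step `stepL2Pos_KSC₃_on`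
(gen 9, with `GA := KACU`, `Cinv := pullS C⁻¹`) transported by `stepL2Pos_of_family_pos` — `hin_KSCU₃_on_pos`, `houtL2_KSCU_on`.  Displayed: the root
frame's structural data and the plaquette law `hplaq` of the regular base (exactly as `B9SectBL2StepRecordOn.stepL2Pos_record_on`).
[cite: Balaban1985BackgroundPropagators, Thm 3.1 (3.46) p.398, Thm 3.4 p.400, (3.63)–(3.67) pp.402–403, p.403 l.1–9, p.404 (after (3.69)); Balaban1984PropagatorsII, Prop. 2.6 (2.140)–(2.141) p.247, Lemma 2.1 p.234] -/
theorem stepL2Pos_KSCU_on [∀ x : MemberY d ℓ hd hL b₀ b₁ Mstar, DecidableEq (geo9Y x).Site] [∀ x : MemberY d ℓ hd hL b₀ b₁ Mstar, Nonempty (geo9Y x).Site]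
    [NormOneClass 𝔸] [DecidableEq ι]
    (hι : ∀ (j : J) (s : BlkY (f j).toKIdx), β (f j).toKIdx.hN (f j).toKIdx.D (f j).toKIdx.hk (ιB j s) = s)
    (hG1 : ∀ u : 𝔸ˣ, u ∈ G → ‖(u : 𝔸)‖ ≤ 1) (hpar : ∀ j (U : CfgY 𝔸 (f j).toKIdx), GVal G (f j).toKIdx U → ∀ z w, par j U z w ∈ G)
    (hunit : ∀ j (U : CfgY 𝔸 (f j).toKIdx), GVal G (f j).toKIdx U → IsUnit (deltaPrimeAY (f j).toKIdx (par j) U))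
    (dB : ℕ) (M₂ : ℝ) (hM₂ : 0 ≤ M₂) (hrepr : ∀ (v : 𝔸) (j : ι), |b.repr v j| ≤ M₂ * ‖v‖) (hcR : 0 < M₂ * ∑ j, ‖b j‖)
    (hcL : 0 < Real.sqrt (Fintype.card ι) * M₂ * ∑ j, ‖b j‖)
    (Cq : ℝ) (hCq : 0 ≤ Cq) (hC37 : ∀ j β' U a, C37 j β' U a → GVal G (f j).toKIdx U ∧ CplxLettersY G (f j) (par j) (ιB j) Cq β' U a)
    (MInv aInv aW : ℝ) (hMInv : 0 < MInv) (haInv : 0 < aInv) (haW : 0 < aW) {cP : ℝ} (hcP : 0 ≤ cP)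
    (hplaq : ∀ (j : J) (α₀ : ℝ) (U : CfgY 𝔸 (f j).toKIdx), (bg9Y 𝔸 G (f j)).Reg335 c35 α₀ U → PlaqLawY (f j) (ιB j) cP U) :
    StepL2Pos dB c35 (fun j => geo9Y (f j)) (fun j => (codingYx G (f j) (C37 j) (C38 j)).bg)
      (fun j => KSCU G (f j) (par j) (C37 j) (C38 j)) (fun j => KACU G (f j) (OA j) (parB j) (C37 j) (C38 j))
      (fun j => pullS (codingYx G (f j) (C37 j) (C38 j)) (Cinv j)) (fun j => KSCU G (f j) (par j) (C37 j) (C38 j)) :=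
  stepL2Pos_of_family_pos dB c35 (fun j => geo9Y (f j)) (fun j => (codingYx G (f j) (C37 j) (C38 j)).bg)
    (fun j => KSC₃ G (f j) (par j) (C37 j) (C38 j)) (fun j => KSCU G (f j) (par j) (C37 j) (C38 j))
    (fun j => KACU G (f j) (OA j) (parB j) (C37 j) (C38 j)) (fun j => KACU G (f j) (OA j) (parB j) (C37 j) (C38 j))
    (fun j => KSC₃ G (f j) (par j) (C37 j) (C38 j)) (fun j => KSCU G (f j) (par j) (C37 j) (C38 j))
    (fun j => pullS (codingYx G (f j) (C37 j) (C38 j)) (Cinv j))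
    (hin_KSCU₃_on_pos f c35 G par OA parB b ιB C37 C38 Cinv hι hG1 hM₂ hrepr dB hcP hplaq)
    (houtL2_KSCU_on f c35 G par C37 C38)
    (stepL2Pos_KSC₃_on f c35 G b C37 C38 par ιB hι hG1 hpar hunit dB M₂ hM₂ hrepr hcR hcL Cq hCq hC37 MInv aInv aW hMInv haInv haW _ _)

end Steps

end Literature.MathematicalPhysics.QuantumFieldTheory.Balaban1983to89.B9SectBStepsKSCUBlocks

end
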